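import Literature.Barriers.ValiantsHypothesis.BILPS19Cor42Machine
import Literature.Barriers.ValiantsHypothesis.BILPS19OrbitClosureContainmentNPHardProofs
import Literature.Barriers.ValiantsHypothesis.BILPS19HMinRank1NPHardProofs
import Literature.Computability.AlgebraicComplexity.BILPS19MinrankOnePencilCover
import Literature.Computability.Complexity.PolyExistsBPPClosure
import Literature.Computability.Complexity.AdaptiveBPPSimulation
import Literature.Computability.Complexity.StringEquality
import HarnessLib

/-!
# Bläser–Ikenmeyer–Lysikov–Pandey–Schreyer 2019, Cor 42 (no `poly(n)`-natural proofs for minrank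
# unless `coNP ⊆ ∃BPP`) REDUCED to a randomised identity test for integer circuits

Theorem-only companion of `BILPS19MembershipHardness.lean` (typed fact `BILPS2019_cor42 F`, the
minrank instance of BILPS Thm 40, arXiv:1911.02534 p0035:L1–L37) assembling the printed `∃BPP`
verifier from its tree-resident pieces: the rank-one pencil charts covering `𝓜_1` exactly and the
vanishing criterion (`BILPS19MinrankOnePencilCover.lean`), the two identity-test circuits of the
verifier and their semantics (`BILPS19Cor42VerifierSemantics.lean`), their polynomial-time writers
(`BILPS19Cor42Machine.lean`), `P^{BPP} = BPP` for bounded adaptive reductions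
(`AdBPPSim.adLang_mem_BPP`), the class step `coNP ⊆ ∃·BPP ⟸ Lᶜ ∈ ∃·BPP` for an NP-hard `L`
(`PolyExistsBPPClosure.lean`) with `L = HMinRank1` (`BILPS2019_cor35_holds`). Printed proof followed:
"guess a circuit `C` of polynomial size … use polynomial identity testing to check whether
`C(g_1, …, g_{p(n)})` is identically zero [for every generator tuple of the variety] … check whether
`f(v) ≠ 0`" (Thm 40), applied to `V = 𝓜_1` ("the minrank problem is NP-hard", Cor 35; "uniformly
generated", Lemma 41 — here by the exact pencil cover instead of the dense orbit map, disclosed in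
the pencil-cover file). Instances below the size threshold `n₀` of the assumed natural proofs are
padded (`𝓜_r` is transported along zero-padding, BILPS Lemma 16; `padT_mem_minrankSet_iff`).

* §1 padding; §2 reading the instance tensor by input position; §3 the chart layout embedding and
  `coordPoly = rename ℓ ∘ pencilGen`; §4 SOUNDNESS (`not_mem_minrankSet_of_tests`) and COMPLETENESS
  (`exists_block_of_isMinrankProof`) of the two tests at the level of guessed blocks;
* §5 the verifier language `∈ BPP` (two adaptive queries to a `BPP` identity test), the witness
  polynomial, `(hmr1Language F)ᶜ ∈ ∃·BPP`;
* **`BILPS2019_cor42_of_randomizedPIT`**: for any `B ∈ BPP` agreeing with `PITLanguage` on circuit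
  words `circuitWord m C` with `m ≤ |circuitWord m C|` (the shape delivered by the tree's randomised
  modular zero test on circuit codes), `BILPS2019_cor42 F` holds for every field `F` of characteristic
  `0`; **`BILPS2019_cor42_of_PIT_mem_BPP : PITLanguage ∈ BPP → BILPS2019_cor42 F`**.

No new facts; the remaining hypothesis is the classical `ACIT ∈ coRP ⊆ BPP` (Schwartz 1980,
Ibarra–Moran 1983), being formalised in the tree separately. HONEST FRAMING (val-lit): a 2019
conditional barrier about the MINRANK varieties with a Boolean hypothesis, reduced inside the tree;
`VP ≠ VNP` is NOT proved and nothing here bears on it.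

## References

* [BlaserIkenmeyerLysikovPandeySchreyer2019] arXiv:1911.02534, §8.3: Def. 38–39, Thm. 40 (proof,
  p0035:L1–L20), Lemma 41, Cor. 42 (p0035:L37); §8.1 Cor. 35; Lemma 16 (padding).
* [AroraBarak2009] S. Arora, B. Barak, *Computational Complexity: A Modern Approach*, CUP 2009,
  Def. 5.3 (∃·), §7.5.2 (`BPP^{BPP} = BPP`), Thm. 8.18 (proof).
* [Schwartz1980] J. T. Schwartz, J. ACM 27 (1980); [IbarraMoran1983] O. Ibarra, S. Moran, J. ACM 30.
-/

noncomputable section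

open MvPolynomial

namespace Literature.Barriers.ValiantsHypothesis

namespace BILPS2019Cor42

open Literature.Computability.AlgebraicComplexity Literature.Computability.Complexity ArithCircuit KIReduction
open BILPS2019MinrankOne BILPS2019Cor37 _root_.Computability CodeFP Brick BILPS19Thm34
open scoped Literature.Computability.Complexity.Notation

universe u

/-! ### §1. Padding the slices -/

section Padding

variable {F : Type u} [Field F] {k n : ℕ}

/-- **The zero-padded tensor**: the `n × n` slices of `T` in the top-left corner of `(n + n₀) × (n + n₀)`
slices. [cite: BlaserIkenmeyerLysikovPandeySchreyer2019, Lemma 16] -/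
def padT (n₀ : ℕ) (T : Fin k → Fin n → Fin n → F) : Fin k → Fin (n + n₀) → Fin (n + n₀) → F :=
  fun a b c => if h : b.1 < n ∧ c.1 < n then T a ⟨b.1, h.1⟩ ⟨c.1, h.2⟩ else 0

/-- The transpose of the `0/1` matrix of an injective map is a left inverse. [folklore] -/
private theorem embMatrix_transpose_mul_self {α β : Type*} [Fintype α] [Fintype β] [DecidableEq α]
    [DecidableEq β] {e : α → β} (he : Function.Injective e) :
    Matrix.transpose (embMatrix F e) * embMatrix F e = 1 := by
  ext a a'
  simp only [Matrix.mul_apply, Matrix.transpose_apply, embMatrix, Matrix.of_apply, mul_ite, mul_one, mul_zero,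
    Matrix.one_apply]
  by_cases h : a = a'
  · subst h
    simp
  · rw [if_neg h]
    refine Finset.sum_eq_zero fun b _ => ?_
    by_cases h1 : e a' = b
    · rw [if_pos h1, if_neg]
      intro h2
      exact h (he (h2.trans h1.symm))
    · rw [if_neg h1]

/-- The padded tensor is the action of `(1, E, E)`, `E` the `0/1` matrix of `Fin n ↪ Fin (n + n₀)`.
[cite: BlaserIkenmeyerLysikovPandeySchreyer2019, Lemma 16 (proof)] -/
theorem padT_eq_actTensor (n₀ : ℕ) (T : Fin k → Fin n → Fin n → F) :
    padT n₀ T = actTensor (1 : Matrix (Fin k) (Fin k) F) (embMatrix F (Fin.castAdd n₀))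
      (embMatrix F (Fin.castAdd n₀)) T := by
  funext a b c
  have hval : ∀ (b' : Fin n) (b : Fin (n + n₀)), Fin.castAdd n₀ b' = b → b'.1 = b.1 := fun b' b h' => by
    rw [← h', Fin.val_castAdd]
  rw [actTensor_apply, Finset.sum_eq_single a]
  · simp only [Matrix.one_apply_eq, one_mul, embMatrix, Matrix.of_apply]
    unfold padT
    by_cases h : b.1 < n ∧ c.1 < n
    · rw [dif_pos h, Finset.sum_eq_single ⟨b.1, h.1⟩, Finset.sum_eq_single ⟨c.1, h.2⟩]
      · have hb : Fin.castAdd n₀ (⟨b.1, h.1⟩ : Fin n) = b := Fin.ext (by simp)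
        have hc : Fin.castAdd n₀ (⟨c.1, h.2⟩ : Fin n) = c := Fin.ext (by simp)
        rw [if_pos hb, if_pos hc]; ring
      · intro c' _ hc'
        have hne : ¬ Fin.castAdd n₀ c' = c := fun h' => hc' (Fin.ext (hval c' c h'))
        rw [if_neg hne]; ring
      · intro h'; exact absurd (Finset.mem_univ _) h'
      · intro b' _ hb'
        have hne : ¬ Fin.castAdd n₀ b' = b := fun h' => hb' (Fin.ext (hval b' b h'))
        rw [if_neg hne]; simp
      · intro h'; exact absurd (Finset.mem_univ _) h'
    · rw [dif_neg h]
      symm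
      refine Finset.sum_eq_zero fun b' _ => Finset.sum_eq_zero fun c' _ => ?_
      rcases not_and_or.1 h with hb | hc
      · have hne : ¬ Fin.castAdd n₀ b' = b := fun h' => hb (by rw [← hval b' b h']; exact b'.isLt)
        rw [if_neg hne]; simp
      · have hne : ¬ Fin.castAdd n₀ c' = c := fun h' => hc (by rw [← hval c' c h']; exact c'.isLt)
        rw [if_neg hne]; simp
  · intro a' _ ha'
    simp [Matrix.one_apply_ne' ha']
  · intro h'; exact absurd (Finset.mem_univ _) h'

/-- **Padding does not change membership in `𝓜_r`** (rank of a padded slice pencil is unchanged).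
[cite: BlaserIkenmeyerLysikovPandeySchreyer2019, Lemma 16] -/
theorem padT_mem_minrankSet_iff (n₀ r : ℕ) (T : Fin k → Fin n → Fin n → F) :
    padT n₀ T ∈ (minrankSet F r : Set (Fin k → Fin (n + n₀) → Fin (n + n₀) → F)) ↔
      T ∈ (minrankSet F r : Set (Fin k → Fin n → Fin n → F)) := by
  rw [padT_eq_actTensor]
  have hE := embMatrix_transpose_mul_self (F := F) (Fin.castAdd_injective n n₀)
  exact actTensor_mem_minrankSet_iff (P' := (1 : Matrix (Fin k) (Fin k) F)) (by simp) (by simp) hE hE r T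

end Padding

/-! ### §2. Reading the instance tensor by input position -/

section Positions

variable {k n : ℕ}

/-- The input position `a n² + b n + c` of the coordinate `(a, b, c)`. [cite: BlaserIkenmeyerLysikovPandeySchreyer2019, Problem 2 (input)] -/
def posIdx (n : ℕ) (v : Fin k × Fin n × Fin n) : ℕ := v.1.1 * n ^ 2 + v.2.1.1 * n + v.2.2.1

/-- Positions are below `k n²`. [cite: BlaserIkenmeyerLysikovPandeySchreyer2019, Problem 2 (input)] -/
theorem posIdx_lt (v : Fin k × Fin n × Fin n) : posIdx n v < nIn k n := by
  obtain ⟨a, b, c⟩ := v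
  have hb := b.isLt; have hc := c.isLt; have ha := a.isLt
  unfold posIdx nIn
  have h1 : b.1 * n + c.1 < n ^ 2 := by nlinarith
  have h2 : (a.1 + 1) * n ^ 2 ≤ k * n ^ 2 := Nat.mul_le_mul_right _ ha
  nlinarith

/-- Decoding the slice index. [cite: BlaserIkenmeyerLysikovPandeySchreyer2019, Problem 2 (input)] -/
theorem posIdx_div_sq (v : Fin k × Fin n × Fin n) : posIdx n v / n ^ 2 = v.1.1 := by
  obtain ⟨a, b, c⟩ := v
  have hn : 0 < n := Nat.pos_of_ne_zero fun h => by subst h; exact absurd b.isLt (Nat.not_lt_zero _)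
  have h1 : b.1 * n + c.1 < n ^ 2 := by have := b.isLt; have := c.isLt; nlinarith
  unfold posIdx
  rw [Nat.add_assoc, Nat.add_comm, Nat.add_mul_div_right _ _ (pow_pos hn 2), Nat.div_eq_of_lt h1, Nat.zero_add]

/-- Decoding the row index. [cite: BlaserIkenmeyerLysikovPandeySchreyer2019, Problem 2 (input)] -/
theorem posIdx_div_mod (v : Fin k × Fin n × Fin n) : posIdx n v / n % n = v.2.1.1 := by
  obtain ⟨a, b, c⟩ := v
  have hn : 0 < n := Nat.pos_of_ne_zero fun h => by subst h; exact absurd b.isLt (Nat.not_lt_zero _)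
  unfold posIdx
  rw [show a.1 * n ^ 2 + b.1 * n + c.1 = c.1 + (b.1 + a.1 * n) * n by ring, Nat.add_mul_div_right _ _ hn,
    Nat.div_eq_of_lt c.isLt, Nat.zero_add, Nat.add_mul_mod_self_right, Nat.mod_eq_of_lt b.isLt]

/-- Decoding the column index. [cite: BlaserIkenmeyerLysikovPandeySchreyer2019, Problem 2 (input)] -/
theorem posIdx_mod (v : Fin k × Fin n × Fin n) : posIdx n v % n = v.2.2.1 := by
  obtain ⟨a, b, c⟩ := v
  unfold posIdx
  rw [show a.1 * n ^ 2 + b.1 * n + c.1 = c.1 + (b.1 + a.1 * n) * n by ring, Nat.add_mul_mod_self_right,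
    Nat.mod_eq_of_lt c.isLt]

/-- **Positions are a bijection** `Fin k × Fin n × Fin n ≃ Fin (k n²)`. [cite: BlaserIkenmeyerLysikovPandeySchreyer2019, Problem 2 (input)] -/
theorem posIdx_injective : Function.Injective (fun v : Fin k × Fin n × Fin n => (⟨posIdx n v, posIdx_lt v⟩ : Fin (nIn k n))) := by
  intro v w h
  have h' : posIdx n v = posIdx n w := congrArg Fin.val h
  obtain ⟨a, b, c⟩ := v
  obtain ⟨a', b', c'⟩ := w
  have h1 := posIdx_div_sq (a, b, c); have h1' := posIdx_div_sq (a', b', c')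
  have h2 := posIdx_div_mod (a, b, c); have h2' := posIdx_div_mod (a', b', c')
  have h3 := posIdx_mod (a, b, c); have h3' := posIdx_mod (a', b', c')
  rw [h'] at h1 h2 h3
  simp only at h1 h1' h2 h2' h3 h3'
  exact Prod.ext (Fin.ext (h1.symm.trans h1')) (Prod.ext (Fin.ext (h2.symm.trans h2')) (Fin.ext (h3.symm.trans h3')))

/-- The position equivalence. [folklore] -/
def posEquiv (k n : ℕ) : (Fin k × Fin n × Fin n) ≃ Fin (nIn k n) :=
  Equiv.ofBijective (fun v => ⟨posIdx n v, posIdx_lt v⟩)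
    ((Fintype.bijective_iff_injective_and_card _).2 ⟨posIdx_injective, by simp [nIn, Fintype.card_prod, pow_two]⟩)

/-- Value of the position equivalence. [cite: BlaserIkenmeyerLysikovPandeySchreyer2019, Problem 2 (input)] -/
@[simp] theorem posEquiv_apply_val (v : Fin k × Fin n × Fin n) : (posEquiv k n v).1 = posIdx n v := rfl

variable {F : Type u} [Field F]

/-- **The padded instance tensor, read by position, is `padEntry`.**
[cite: BlaserIkenmeyerLysikovPandeySchreyer2019, Problem 2 (input) and Lemma 16] -/
theorem padT_hmrTensorOfList (n₀ : ℕ) (l : List ℤ) (v : Fin k × Fin (n + n₀) × Fin (n + n₀)) :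
    trilinearPt (padT n₀ (hmrTensorOfList F n k l)) v = ((padEntry n n₀ l (posIdx (n + n₀) v) : ℤ) : F) := by
  obtain ⟨a, b, c⟩ := v
  simp only [trilinearPt, padT, padEntry]
  rw [posIdx_div_sq (a, b, c), posIdx_div_mod (a, b, c), posIdx_mod (a, b, c)]
  simp only
  split_ifs with h
  · rfl
  · simp

end Positions

/-! ### §3. The layout of the chart variables and the coordinate polynomials -/

section LayoutLink

variable {k n : ℕ}

/-- **The layout of the chart parameters** among the `M = nVar k n` identity-test variables:
`S_{abc} ↦ a n² + b n + c`, `x_a ↦ N + a`, `u_b ↦ N + k + b`, `v_c ↦ N + k + n + c`.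
[cite: BlaserIkenmeyerLysikovPandeySchreyer2019, Thm. 40 (proof: the parameters of the parametrisation)] -/
def layoutIdx (k n : ℕ) : PencilParams k n → ℕ
  | Sum.inl v => posIdx n v
  | Sum.inr (Sum.inl a) => xIdx k n a.1
  | Sum.inr (Sum.inr (Sum.inl b)) => uIdx k n b.1
  | Sum.inr (Sum.inr (Sum.inr c)) => vIdx k n c.1

/-- Layout indices are below `nLow k n ≤ nVar k n`. [folklore] -/
private theorem layoutIdx_lt_nLow (q : PencilParams k n) : layoutIdx k n q < nLow k n := by
  rcases q with v | a | b | c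
  · have := posIdx_lt v; simp only [layoutIdx, nLow]; unfold nIn at this; omega
  · have := a.isLt; simp only [layoutIdx, xIdx, nLow]; omega
  · have := b.isLt; simp only [layoutIdx, uIdx, nLow]; omega
  · have := c.isLt; simp only [layoutIdx, vIdx, nLow]; omega

/-- Layout indices are variables. [folklore] -/
private theorem layoutIdx_lt (q : PencilParams k n) : layoutIdx k n q < nVar k n := by
  have := layoutIdx_lt_nLow q; rw [nVar_eq]; omega

/-- **The layout embedding** `PencilParams k n ↪ Fin (nVar k n)`. [cite: BlaserIkenmeyerLysikovPandeySchreyer2019, Thm. 40 (proof)] -/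
def layout (k n : ℕ) (q : PencilParams k n) : Fin (nVar k n) := ⟨layoutIdx k n q, layoutIdx_lt q⟩

/-- The layout is injective. [cite: BlaserIkenmeyerLysikovPandeySchreyer2019, Thm. 40 (proof)] -/
theorem layout_injective : Function.Injective (layout k n) := by
  intro q q' h
  have h' : layoutIdx k n q = layoutIdx k n q' := congrArg Fin.val h
  rcases q with v | a | b | c <;> rcases q' with v' | a' | b' | c' <;>
    simp only [layoutIdx, xIdx, uIdx, vIdx] at h'
  · exact congrArg Sum.inl (posIdx_injective (Fin.ext h'))
  · have := posIdx_lt v; unfold nIn at this; omega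
  · have := posIdx_lt v; unfold nIn at this; omega
  · have := posIdx_lt v; unfold nIn at this; omega
  · have := posIdx_lt v'; unfold nIn at this; omega
  · have : a = a' := Fin.ext (by omega)
    subst this; rfl
  · have := a.isLt; omega
  · have := a.isLt; omega
  · have := posIdx_lt v'; unfold nIn at this; omega
  · have := a'.isLt; omega
  · have : b = b' := Fin.ext (by omega)
    subst this; rfl
  · have := b.isLt; omega
  · have := posIdx_lt v'; unfold nIn at this; omega
  · have := a'.isLt; omega
  · have := b'.isLt; omega
  · have : c = c' := Fin.ext (by omega)
    subst this; rfl

/-- Sums over `Fin k` with one index erased, as sums over `range k`. [folklore] -/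
private theorem sum_erase_fin {β : Type*} [AddCommGroup β] (f : ℕ → β) (a₀ : Fin k) :
    ∑ a ∈ Finset.univ.erase a₀, f a.1 = ∑ a' ∈ (Finset.range k).erase a₀.1, f a' := by
  rw [Finset.sum_erase_eq_sub (Finset.mem_univ a₀), Finset.sum_erase_eq_sub (Finset.mem_range.2 a₀.isLt),
    Fin.sum_univ_eq_sum_range]

/-- **The coordinate polynomial of a position is the laid-out pencil generator**:
`coordPoly a₀ (a n² + b n + c) = rename layout (pencilGen a₀ (a, b, c))`.
[cite: BlaserIkenmeyerLysikovPandeySchreyer2019, Thm. 40 (proof: g_1, …, g_{p(n)})] -/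
theorem coordPoly_posIdx (a₀ : Fin k) (v : Fin k × Fin n × Fin n) :
    coordPoly k n a₀.1 (posIdx n v) = rename (layout k n) (pencilGen ℤ k n a₀ v) := by
  obtain ⟨a, b, c⟩ := v
  have hd := posIdx_div_sq (a, b, c); have hbm := posIdx_div_mod (a, b, c); have hcm := posIdx_mod (a, b, c)
  simp only at hd hbm hcm
  have hX : ∀ q : PencilParams k n, varP (nVar k n) (layoutIdx k n q) = X (layout k n q) := fun q =>
    varP_of_lt (layoutIdx_lt q)
  unfold coordPoly pencilGen
  rw [hd, hbm, hcm]
  by_cases h : a = a₀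
  · subst h
    rw [if_pos rfl, if_pos rfl, map_sub, map_mul, rename_X, rename_X, map_sum, ← hX, ← hX]
    simp only [layoutIdx]
    congr 1
    rw [← sum_erase_fin (fun a' => varP (nVar k n) (xIdx k n a') * varP (nVar k n) (a' * n ^ 2 + b.1 * n + c.1)) a]
    refine Finset.sum_congr rfl fun x _ => ?_
    rw [map_mul, rename_X, rename_X, ← hX, ← hX]
    rfl
  · have h' : ¬ a.1 = a₀.1 := fun h' => h (Fin.ext h')
    rw [if_neg h', if_neg h, rename_X, ← hX]
    rfl

variable (F : Type u) [Field F]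

/-- **Chart substitution through the layout**: substituting the coordinate polynomials of chart
`a₀` into a block polynomial `Q` (in the `N` positions) is — up to the injective layout renaming —
the pencil substitution `Φ_{a₀}` applied to `Q` read in the coordinates `(a, b, c)`.
[cite: BlaserIkenmeyerLysikovPandeySchreyer2019, Thm. 40 (proof: "C(g_1, …, g_{p(n)})")] -/
theorem aeval_coordPoly_eq_rename_pencilSubst (a₀ : Fin k) (Q : MvPolynomial (Fin (nIn k n)) ℤ) :
    aeval (fun i : Fin (nIn k n) => coordPoly k n a₀.1 i.1) Q =
      rename (layout k n) (pencilSubst ℤ k n a₀ (rename (posEquiv k n).symm Q)) := by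
  have hQ : Q = rename (posEquiv k n) (rename (posEquiv k n).symm Q) := by
    rw [rename_rename, Equiv.self_comp_symm, rename_id_apply]
  conv_lhs => rw [hQ]
  rw [aeval_rename, pencilSubst, ← aeval_eq_bind₁, comp_aeval_apply]
  have hfun : ((fun i : Fin (nIn k n) => coordPoly k n a₀.1 i.1) ∘ (posEquiv k n)) =
      fun v => rename (layout k n) (pencilGen ℤ k n a₀ v) := by
    funext v
    simp only [Function.comp_apply, posEquiv_apply_val]
    exact coordPoly_posIdx a₀ v
  rw [hfun]

end LayoutLink

/-! ### §4. Soundness and completeness of the two tests, at the level of guessed blocks -/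

section Tests

variable (F : Type u) [Field F] [CharZero F] {k n n₀ : ℕ}

omit [CharZero F] in
/-- **Reading the block polynomial at the padded instance, in `F`**: the integer value tested by the
evaluation circuit, cast to `F`, is the value at the padded tensor of the block polynomial read in
the coordinates `(a, b, c)`. [cite: BlaserIkenmeyerLysikovPandeySchreyer2019, Thm. 40 (proof: "check whether f(v) ≠ 0")] -/
theorem cast_eval_blockPoly (l : List ℤ) (Q : MvPolynomial (Fin (nIn k (n + n₀))) ℤ) :
    ((eval (fun i : Fin (nIn k (n + n₀)) => padEntry n n₀ l i.1) Q : ℤ) : F) =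
      eval (trilinearPt (padT n₀ (hmrTensorOfList F n k l)))
        (map (Int.castRingHom F) (rename (posEquiv k (n + n₀)).symm Q)) := by
  have hpt : trilinearPt (padT n₀ (hmrTensorOfList F n k l)) =
      (Int.castRingHom F) ∘ fun v => padEntry n n₀ l (posIdx (n + n₀) v) := funext (padT_hmrTensorOfList n₀ l)
  have hev : eval (fun i : Fin (nIn k (n + n₀)) => padEntry n n₀ l i.1) Q =
      eval (fun v : Fin k × Fin (n + n₀) × Fin (n + n₀) => padEntry n n₀ l (posIdx (n + n₀) v))
        (rename (posEquiv k (n + n₀)).symm Q) := by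
    rw [MvPolynomial.eval_rename]
    have hfun : ((fun v : Fin k × Fin (n + n₀) × Fin (n + n₀) => padEntry n n₀ l (posIdx (n + n₀) v)) ∘
        (posEquiv k (n + n₀)).symm) = fun i : Fin (nIn k (n + n₀)) => padEntry n n₀ l i.1 := by
      funext i
      simp only [Function.comp_apply, ← posEquiv_apply_val, Equiv.apply_symm_apply]
    rw [hfun]
  rw [hpt, hev, ← MvPolynomial.map_eval]
  rfl

/-- **SOUNDNESS of the two tests.** If the chart-test circuit of a guessed block computes `0` and
its evaluation circuit at the zero-padded instance does not, then the instance tensor is NOT in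
`𝓜_1(F)`: the block polynomial vanishes on every pencil chart, hence on `𝓜_1` (exact cover), but
not at the padded tensor, and padding preserves `𝓜_1`. [cite: BlaserIkenmeyerLysikovPandeySchreyer2019, Thm. 40 (proof) and Lemma 16] -/
theorem not_mem_minrankSet_of_tests (l : List ℤ) (B : KBlock)
    (hchart : (chartCircuit k (n + n₀) B).eval = 0)
    (heval : (evalCircuit (nIn k (n + n₀)) (padEntry n n₀ l) B).eval ≠ 0) :
    hmrTensorOfList F n k l ∉ (minrankSet F 1 : Set (Fin k → Fin n → Fin n → F)) := by
  haveI : Infinite F := Infinite.of_injective _ Nat.cast_injective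
  set P := rename (posEquiv k (n + n₀)).symm (blockPoly (nIn k (n + n₀)) B) with hP
  have hvan : ∀ a₀ : Fin k, pencilSubst ℤ k (n + n₀) a₀ P = 0 := fun a₀ => by
    have h := (eval_chartCircuit_eq_zero_iff k (n + n₀) B).1 hchart a₀.1 a₀.isLt
    rw [aeval_coordPoly_eq_rename_pencilSubst, ← hP] at h
    exact rename_injective _ layout_injective (by rw [h, map_zero])
  have hvanF := (map_vanishes_on_minrankSet_one_iff (F := F) P).2 hvan
  intro hT
  have hT' := (padT_mem_minrankSet_iff n₀ 1 (hmrTensorOfList F n k l)).2 hT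
  have h0 := hvanF _ hT'
  rw [hP, ← cast_eval_blockPoly F l, Int.cast_eq_zero, ← eval_evalCircuit_eq_zero_iff] at h0
  exact heval h0

/-- **COMPLETENESS of the two tests.** A natural proof of constant-free size `≤ s` for the padded
instance tensor (against `𝓜_1`) yields a guessed block of length `≤ s + 1`, references inside its
use, passing both tests. [cite: BlaserIkenmeyerLysikovPandeySchreyer2019, Cor. 42 (proof) and Thm. 40 (proof)] -/
theorem exists_block_of_isMinrankProof (l : List ℤ) {s : ℕ}
    {p : MvPolynomial (Fin k × Fin (n + n₀) × Fin (n + n₀)) F}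
    (hp : IsMinrankProof F (padT n₀ (hmrTensorOfList F n k l)) 1 s p) :
    ∃ B : KBlock, B.length ≤ s + 1 ∧
      (∀ g ∈ B, g.a.idx < nIn k (n + n₀) + B.length ∧ g.b.idx < nIn k (n + n₀) + B.length) ∧
      (chartCircuit k (n + n₀) B).eval = 0 ∧
      (evalCircuit (nIn k (n + n₀)) (padEntry n n₀ l) B).eval ≠ 0 := by
  haveI : Infinite F := Infinite.of_injective _ Nat.cast_injective
  obtain ⟨hne, hvan, P₀, h2, hs, hcomp, hsize⟩ := hp
  set e := posEquiv k (n + n₀) with he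
  obtain ⟨B, hlen, hidx, hmap⟩ := exists_kblock_of_circuit (P₀.rename e) (h2.rename _) (hs.rename _)
  have hQ : map (Int.castRingHom F) (blockPoly (nIn k (n + n₀)) B) = rename e p := by
    rw [hmap, eval_rename_apply, hcomp]
  set P := rename e.symm (blockPoly (nIn k (n + n₀)) B) with hP
  have hPp : map (Int.castRingHom F) P = p := by
    rw [hP, map_rename, hQ, rename_rename, Equiv.symm_comp_self, rename_id_apply]
  refine ⟨B, by rw [hlen, size_rename]; omega, hidx, ?_, ?_⟩
  · refine (eval_chartCircuit_eq_zero_iff k (n + n₀) B).2 fun a₀ ha₀ => ?_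
    have hv : pencilSubst ℤ k (n + n₀) ⟨a₀, ha₀⟩ P = 0 :=
      (map_vanishes_on_minrankSet_one_iff (F := F) P).1 (by rw [hPp]; exact hvan) ⟨a₀, ha₀⟩
    have := aeval_coordPoly_eq_rename_pencilSubst ⟨a₀, ha₀⟩ (blockPoly (nIn k (n + n₀)) B)
    rw [this, ← hP, hv, map_zero]
  · intro h0
    rw [eval_evalCircuit_eq_zero_iff] at h0
    apply hne
    rw [← hPp, hP, ← cast_eval_blockPoly F l, h0, Int.cast_zero]

end Tests

/-! ### §5. The `∃·BPP` verifier: two adaptive queries to a randomised identity test -/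

section Verifier

open AdQuery

variable (n₀ : ℕ)

/-- The chart-test writer of `BILPS19Cor42Machine.lean` as a string function. [cite: BlaserIkenmeyerLysikovPandeySchreyer2019, Thm. 40 (proof)] -/
def chartFn : List Bool → List Bool := Classical.choose (exists_chartFn n₀)

/-- `chartFn ∈ FP`. [cite: AroraBarak2009, §1.3] -/
theorem chartFn_mem_FP : chartFn n₀ ∈ FP := (Classical.choose_spec (exists_chartFn n₀)).1

/-- Value of `chartFn` on an input pair. [cite: BlaserIkenmeyerLysikovPandeySchreyer2019, Thm. 40 (proof)] -/
theorem chartFn_apply (w y : List Bool) : chartFn n₀ (boolPair w y) = wordE (chartInst n₀ (decT w, y)) :=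
  (Classical.choose_spec (exists_chartFn n₀)).2 w y

/-- The evaluation writer as a string function. [cite: BlaserIkenmeyerLysikovPandeySchreyer2019, Thm. 40 (proof)] -/
def evalFn : List Bool → List Bool := Classical.choose (exists_evalFn n₀)

/-- `evalFn ∈ FP`. [cite: AroraBarak2009, §1.3] -/
theorem evalFn_mem_FP : evalFn n₀ ∈ FP := (Classical.choose_spec (exists_evalFn n₀)).1

/-- Value of `evalFn` on an input pair. [cite: BlaserIkenmeyerLysikovPandeySchreyer2019, Thm. 40 (proof)] -/
theorem evalFn_apply (w y : List Bool) : evalFn n₀ (boolPair w y) = wordE (evalInst n₀ (decT w, y)) :=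
  (Classical.choose_spec (exists_evalFn n₀)).2 w y

/-- The main-case test (canonical code and guard) as a string function. [cite: AroraBarak2009, §1.3] -/
def mainFn : List Bool → List Bool := Classical.choose exists_mainFn

/-- `mainFn ∈ FP`. [cite: AroraBarak2009, §1.3] -/
theorem mainFn_mem_FP : mainFn ∈ FP := (Classical.choose_spec exists_mainFn).1

/-- Value of `mainFn`. [cite: AroraBarak2009, §1.3] -/
theorem mainFn_apply (w y : List Bool) : mainFn (boolPair w y) = [decide (instE (decT w) = w) && guard (decT w)] :=
  (Classical.choose_spec exists_mainFn).2 w y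

/-- The easy-accept test as a string function. [cite: AroraBarak2009, §1.3] -/
def easyFn : List Bool → List Bool := Classical.choose exists_easyFn

/-- `easyFn ∈ FP`. [cite: AroraBarak2009, §1.3] -/
theorem easyFn_mem_FP : easyFn ∈ FP := (Classical.choose_spec exists_easyFn).1

/-- Value of `easyFn`. [cite: AroraBarak2009, §1.3] -/
theorem easyFn_apply (w y : List Bool) : easyFn (boolPair w y) = [!decide (instE (decT w) = w) || easy (decT w)] :=
  (Classical.choose_spec exists_easyFn).2 w y

/-- **The query map**: first the chart-test word, then the evaluation word (one answer received).
[cite: BlaserIkenmeyerLysikovPandeySchreyer2019, Thm. 40 (proof)] -/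
theorem exists_queryFn : ∃ Q ∈ FP, ∀ z bits : List Bool,
    Q (boolPair z bits) = if bits.length = 0 then chartFn n₀ z else evalFn n₀ z := by
  have hc : CodeFP strE strE (chartFn n₀) := of_fn _ (chartFn_mem_FP n₀) fun _ => rfl
  have he : CodeFP strE strE (evalFn n₀) := of_fn _ (evalFn_mem_FP n₀) fun _ => rfl
  obtain ⟨Q, hQ, hQw⟩ := (natEq.comp ((strNatLength.comp (snd strE strE)).pair (const _ 0))).ite
    (hc.comp (fst _ _)) (he.comp (fst _ _))
  refine ⟨Q, hQ, fun z bits => ?_⟩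
  have h := hQw (z, bits)
  simp only [pairE_apply, decide_eq_true_eq] at h
  exact h

/-- The query map. [cite: BlaserIkenmeyerLysikovPandeySchreyer2019, Thm. 40 (proof)] -/
def queryFn : List Bool → List Bool := Classical.choose (exists_queryFn n₀)

/-- `queryFn ∈ FP`. [cite: AroraBarak2009, §1.3] -/
theorem queryFn_mem_FP : queryFn n₀ ∈ FP := (Classical.choose_spec (exists_queryFn n₀)).1

/-- Value of the query map. [cite: BlaserIkenmeyerLysikovPandeySchreyer2019, Thm. 40 (proof)] -/
theorem queryFn_apply (z bits : List Bool) :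
    queryFn n₀ (boolPair z bits) = if bits.length = 0 then chartFn n₀ z else evalFn n₀ z :=
  (Classical.choose_spec (exists_queryFn n₀)).2 z bits

/-- **The decision language**: accept iff the answers were (yes, no) — the chart test vanishes and
the value does not. [cite: BlaserIkenmeyerLysikovPandeySchreyer2019, Thm. 40 (proof)] -/
def decLang : Language Bool := {v | sndF v = [true, false]}

/-- `decLang ∈ P`. [cite: AroraBarak2009, §1.3] -/
theorem decLang_mem_P : decLang ∈ Classes.P :=
  setOf_apply_eq_apply_mem_P sndF_mem_FP (const_mem_FP [true, false])

variable (B : Language Bool)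

/-- **The two-query language**: the bounded adaptive reduction asking `B` the chart-test word and
the evaluation word. [cite: BlaserIkenmeyerLysikovPandeySchreyer2019, Thm. 40 (proof)] -/
def twoQuery : Language Bool := adLang (queryFn n₀) (Polynomial.C 2) decLang B

/-- **`twoQuery ∈ BPP` for `B ∈ BPP`** (`P^{BPP} = BPP` for bounded adaptive reductions).
[cite: AroraBarak2009, §7.5.2] -/
theorem twoQuery_mem_BPP (hB : B ∈ BPP) : twoQuery n₀ B ∈ BPP :=
  AdBPPSim.adLang_mem_BPP hB (queryFn_mem_FP n₀) _ decLang_mem_P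

/-- **Membership in the two-query language**: the chart-test word is in `B` and the evaluation word
is not. [cite: BlaserIkenmeyerLysikovPandeySchreyer2019, Thm. 40 (proof)] -/
theorem mem_twoQuery_iff (z : List Bool) : z ∈ twoQuery n₀ B ↔ chartFn n₀ z ∈ B ∧ evalFn n₀ z ∉ B := by
  rw [twoQuery, mem_adLang_iff, Polynomial.eval_C]
  have h2 : adBits (queryFn n₀) B z 2 = [B.boolIndicator (chartFn n₀ z), B.boolIndicator (evalFn n₀ z)] := by
    rw [show (2 : ℕ) = 0 + 1 + 1 from rfl, adBits_succ, adBits_succ, adBits_zero, queryFn_apply, List.nil_append,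
      queryFn_apply]
    simp
  rw [h2]
  change sndF (boolPair z [B.boolIndicator (chartFn n₀ z), B.boolIndicator (evalFn n₀ z)]) = [true, false] ↔ _
  have hc : chartFn n₀ z ∈ B ↔ Set.boolIndicator B (chartFn n₀ z) = true :=
    Set.mem_iff_boolIndicator (B : Set (List Bool)) _
  have he : evalFn n₀ z ∈ B ↔ Set.boolIndicator B (evalFn n₀ z) = true :=
    Set.mem_iff_boolIndicator (B : Set (List Bool)) _
  rw [sndF_boolPair, hc, he]
  cases Set.boolIndicator B (chartFn n₀ z) <;> cases Set.boolIndicator B (evalFn n₀ z) <;> simp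

/-- **The verifier language**: easy accept, or main case and the two queries succeed.
[cite: BlaserIkenmeyerLysikovPandeySchreyer2019, Thm. 40 (proof)] -/
def verifier : Language Bool :=
  ({z | easyFn z = [true]} : Language Bool) ⊔ (({z | mainFn z = [true]} : Language Bool) ⊓ twoQuery n₀ B)

/-- `BPP` is closed under union with a `P` language (complements and intersection).
[cite: AroraBarak2009, §7.1] -/
theorem union_mem_BPP_of_mem_P_left {K L : Language Bool} (hK : K ∈ Classes.P) (hL : L ∈ BPP) :
    K ⊔ L ∈ BPP := by
  have hco : ∀ X : Language Bool, X ∈ BPP → Xᶜ ∈ BPP := fun X hX => by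
    have h : Xᶜ ∈ co BPP := by change Xᶜᶜ ∈ BPP; rwa [compl_compl]
    rwa [co_BPP_holds] at h
  have h := hco _ (inter_mem_BPP_of_mem_P_left (compl_mem_P_iff.2 hK) (hco L hL))
  rwa [compl_inf, compl_compl, compl_compl] at h

/-- **The verifier language is in `BPP`** for `B ∈ BPP`. [cite: BlaserIkenmeyerLysikovPandeySchreyer2019, Thm. 40 (proof)] -/
theorem verifier_mem_BPP (hB : B ∈ BPP) : verifier n₀ B ∈ BPP :=
  union_mem_BPP_of_mem_P_left (setOf_apply_eq_apply_mem_P easyFn_mem_FP (const_mem_FP [true]))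
    (inter_mem_BPP_of_mem_P_left (setOf_apply_eq_apply_mem_P mainFn_mem_FP (const_mem_FP [true]))
      (twoQuery_mem_BPP n₀ B hB))

end Verifier

/-! ### §6. Correctness of the verifier and the `∃·BPP` presentation of the complement -/

section Correctness

variable (F : Type u) [Field F] [CharZero F]

omit [CharZero F] in
/-- The number of gates is at most the length of the code word. [cite: KabanetsImpagliazzo2003, §2 (p. 357)] -/
theorem size_le_length_circuitWord {m : ℕ} (C : ArithCircuit ℤ (Fin m)) : C.size ≤ (circuitWord m C).length := by
  rw [circuitWord, encodeArithCircuit_eq, length_boolPair, length_boolPair, length_boolPair]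
  simp only [ones, List.length_replicate, size]
  omega

omit [CharZero F] in
/-- The chart-test word is long enough to host its variables (the ballast).
[cite: BlaserIkenmeyerLysikovPandeySchreyer2019, Thm. 40 (proof)] -/
theorem nVar_le_length_circuitWord (k n : ℕ) (Bk : KBlock) :
    nVar k n ≤ (circuitWord (nVar k n) (chartCircuit k n Bk)).length :=
  le_trans (by rw [size_chartCircuit]; omega) (size_le_length_circuitWord _)

omit [CharZero F] in
/-- Codes in the language decode into the set. [cite: AroraBarak2009, §0.1] -/
theorem decT_mem_of_mem {w : List Bool} (hw : w ∈ hmr1Language F) : instE (decT w) = w ∧ decT w ∈ hmr1Set F := by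
  rw [hmr1Language_eq] at hw
  obtain ⟨x, hx, rfl⟩ := hw
  rw [instE_eq, decT_instE]
  exact ⟨rfl, hx⟩

omit [CharZero F] in
/-- Members of the set have codes in the language. [cite: AroraBarak2009, §0.1] -/
theorem instE_mem_of_mem {x : ℕ × ℕ × List ℤ × ℕ} (hx : x ∈ hmr1Set F) : instE x ∈ hmr1Language F := by
  rw [hmr1Language_eq, ← instE_eq]
  exact (Encoding.mem_toLanguage_iff _ _ _).2 hx

omit [CharZero F] in
/-- With no slices nothing is in `𝓜_1`. [cite: BlaserIkenmeyerLysikovPandeySchreyer2019, Def. 15] -/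
theorem not_mem_minrankSet_of_k_zero {n r : ℕ} (T : Fin 0 → Fin n → Fin n → F) :
    T ∉ (minrankSet F r : Set (Fin 0 → Fin n → Fin n → F)) := by
  rintro ⟨x, hx, -⟩
  exact hx (funext fun i => i.elim0)

omit [CharZero F] in
/-- With empty slices (`n = 0`) and at least one slice everything is in `𝓜_1`.
[cite: BlaserIkenmeyerLysikovPandeySchreyer2019, Def. 15] -/
theorem mem_minrankSet_of_n_zero {k r : ℕ} (hk : 1 ≤ k) (T : Fin k → Fin 0 → Fin 0 → F) :
    T ∈ (minrankSet F r : Set (Fin k → Fin 0 → Fin 0 → F)) := by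
  refine ⟨fun _ => 1, fun h => one_ne_zero (congr_fun h ⟨0, hk⟩), ?_⟩
  exact (Matrix.rank_le_width _).trans (by simp)

/-- Reading the easy test. [folklore] -/
private theorem easy_eq_true_iff (x : ℕ × ℕ × List ℤ × ℕ) :
    easy x = true ↔ ¬ (x.2.2.1.length = x.2.1 * x.1 ^ 2 ∧ x.2.2.2 = 1) ∨ x.2.1 = 0 := by
  unfold easy
  by_cases h1 : x.2.2.1.length = x.2.1 * x.1 ^ 2 <;> by_cases h2 : x.2.2.2 = 1 <;> by_cases h3 : x.2.1 = 0 <;>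
    simp [h1, h2, h3]

/-- Reading the guard. [folklore] -/
private theorem guard_eq_true_iff (x : ℕ × ℕ × List ℤ × ℕ) :
    guard x = true ↔ x.2.2.1.length = x.2.1 * x.1 ^ 2 ∧ x.2.2.2 = 1 ∧ 1 ≤ x.1 ∧ 1 ≤ x.2.1 := by
  simp only [guard, Bool.and_eq_true, decide_eq_true_eq, and_assoc]

omit [CharZero F] in
/-- **Easy instances are outside `HMinRank1`.** [cite: BlaserIkenmeyerLysikovPandeySchreyer2019, Problem 2 and Def. 15] -/
theorem not_mem_hmr1Set_of_easy {x : ℕ × ℕ × List ℤ × ℕ} (he : easy x = true) : x ∉ hmr1Set F := by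
  rw [easy_eq_true_iff] at he
  obtain ⟨n, k, l, r⟩ := x
  rintro ⟨hwf, hr, hT⟩
  simp only [HMRWellFormed] at hwf hr he hT
  rcases he with he | he
  · exact he ⟨hwf, hr⟩
  · subst he
    exact not_mem_minrankSet_of_k_zero F _ hT

/-- **Guarded instances passing both tests are outside `HMinRank1`** (block-level soundness).
[cite: BlaserIkenmeyerLysikovPandeySchreyer2019, Thm. 40 (proof)] -/
theorem not_mem_hmr1Set_of_tests {n₀ : ℕ} {x : ℕ × ℕ × List ℤ × ℕ} {y : List Bool}
    (hchart : (chartCircuit x.2.1 (x.1 + n₀) (readBlock y)).eval = 0)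
    (heval : (evalCircuit (nIn x.2.1 (x.1 + n₀)) (padEntry x.1 n₀ x.2.2.1) (readBlock y)).eval ≠ 0) :
    x ∉ hmr1Set F := by
  obtain ⟨n, k, l, r⟩ := x
  rintro ⟨-, -, hT⟩
  exact not_mem_minrankSet_of_tests F l (readBlock y) hchart heval hT

variable {B : Language Bool}

/-- **SOUNDNESS of the verifier**: an accepted pair has its instance outside `HMinRank1`.
[cite: BlaserIkenmeyerLysikovPandeySchreyer2019, Thm. 40 (proof)] -/
theorem not_mem_of_mem_verifier (hagree : ∀ (m : ℕ) (C : ArithCircuit ℤ (Fin m)),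
      m ≤ (circuitWord m C).length → (circuitWord m C ∈ B ↔ C.eval = 0))
    {n₀ : ℕ} {w y : List Bool} (h : boolPair w y ∈ verifier n₀ B) : w ∉ hmr1Language F := by
  intro hw
  obtain ⟨hcanon, hx⟩ := decT_mem_of_mem F hw
  rcases h with he | ⟨hm, hq⟩
  · have he' : easyFn (boolPair w y) = [true] := he
    rw [easyFn_apply] at he'
    simp only [List.cons.injEq, and_true, Bool.or_eq_true, Bool.not_eq_true', decide_eq_false_iff_not] at he'
    rcases he' with he' | he'
    · exact he' hcanon
    · exact not_mem_hmr1Set_of_easy F he' hx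
  · have hm' : mainFn (boolPair w y) = [true] := hm
    rw [mainFn_apply] at hm'
    simp only [List.cons.injEq, and_true, Bool.and_eq_true, decide_eq_true_eq] at hm'
    obtain ⟨-, hg⟩ := hm'
    have hq' := (mem_twoQuery_iff n₀ B (boolPair w y)).1 hq
    rw [chartFn_apply, evalFn_apply, wordE_chartInst (s := (decT w, y)) hg, wordE_evalInst (s := (decT w, y)) hg,
      hagree _ _ (nVar_le_length_circuitWord _ _ _), hagree _ _ (Nat.zero_le _)] at hq'
    exact not_mem_hmr1Set_of_tests F (n₀ := n₀) hq'.1 hq'.2 hx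

omit [CharZero F] in
/-- The entry list is no longer than the instance code. [cite: AroraBarak2009, §0.1] -/
theorem length_entries_le (x : ℕ × ℕ × List ℤ × ℕ) : x.2.2.1.length ≤ (instE x).length := by
  obtain ⟨n, k, l, r⟩ := x
  simp only [instE, pairE_apply, length_boolPair, listE, length_unE]
  omega

/-- **The witness polynomial**: a bound on the code length of the guessed block.
[cite: BlaserIkenmeyerLysikovPandeySchreyer2019, Thm. 40 (proof: "a circuit of polynomial size")] -/
def witnessPoly (c₀ n₀ : ℕ) : Polynomial ℕ :=
  ((Polynomial.X + Polynomial.C n₀) ^ c₀ + Polynomial.C c₀ + 1) *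
    (6 * (Polynomial.X * (Polynomial.X + Polynomial.C n₀) ^ 2 + (Polynomial.X + Polynomial.C n₀) ^ c₀ +
      Polynomial.C c₀ + 1) + 58)

/-- Evaluation of the witness polynomial. [folklore] -/
private theorem eval_witnessPoly (c₀ n₀ L : ℕ) : (witnessPoly c₀ n₀).eval L =
    ((L + n₀) ^ c₀ + c₀ + 1) * (6 * (L * (L + n₀) ^ 2 + (L + n₀) ^ c₀ + c₀ + 1) + 58) := by
  simp [witnessPoly]

/-- **Block-level completeness for a guarded instance** outside `HMinRank1`, under the natural-proof
hypothesis (size exponent `c₀`, threshold `n₀`): a short guessed block passing both tests.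
[cite: BlaserIkenmeyerLysikovPandeySchreyer2019, Cor. 42 (proof) and Thm. 40 (proof)] -/
theorem exists_block_of_not_mem {c₀ n₀ : ℕ}
    (hnat : ∀ n : ℕ, n₀ ≤ n → ∀ (m : ℕ) (T : Fin m → Fin n → Fin n → F),
      (∀ v, ∃ q : ℚ, trilinearPt T v = (q : F)) →
        T ∉ (minrankSet F 1 : Set (Fin m → Fin n → Fin n → F)) → ∃ p, IsMinrankProof F T 1 (n ^ c₀ + c₀) p)
    {x : ℕ × ℕ × List ℤ × ℕ} (hx : x ∉ hmr1Set F) (hez : easy x = false) :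
    guard x = true ∧ ∃ Bk : KBlock, Bk.length ≤ (x.1 + n₀) ^ c₀ + c₀ + 1 ∧
      (∀ g ∈ Bk, g.a.idx < nIn x.2.1 (x.1 + n₀) + Bk.length ∧ g.b.idx < nIn x.2.1 (x.1 + n₀) + Bk.length) ∧
      (chartCircuit x.2.1 (x.1 + n₀) Bk).eval = 0 ∧
      (evalCircuit (nIn x.2.1 (x.1 + n₀)) (padEntry x.1 n₀ x.2.2.1) Bk).eval ≠ 0 := by
  have hez' : ¬ (easy x = true) := by rw [hez]; exact Bool.false_ne_true
  rw [easy_eq_true_iff, not_or, not_not] at hez'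
  obtain ⟨⟨hwf, hr⟩, hk⟩ := hez'
  obtain ⟨n, k, l, r⟩ := x
  simp only at hwf hr hk ⊢
  subst hr
  have hk1 : 1 ≤ k := Nat.one_le_iff_ne_zero.2 hk
  have hT : hmrTensorOfList F n k l ∉ (minrankSet F 1 : Set (Fin k → Fin n → Fin n → F)) := fun hT =>
    hx ⟨hwf, rfl, hT⟩
  have hn1 : 1 ≤ n := by
    rcases Nat.eq_zero_or_pos n with rfl | hn
    · exact absurd (mem_minrankSet_of_n_zero F hk1 _) hT
    · exact hn
  refine ⟨(guard_eq_true_iff _).2 ⟨hwf, rfl, hn1, hk1⟩, ?_⟩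
  have hT' := mt (padT_mem_minrankSet_iff (F := F) n₀ 1 (hmrTensorOfList F n k l)).1 hT
  have hrat : ∀ v, ∃ q : ℚ, trilinearPt (padT n₀ (hmrTensorOfList F n k l)) v = (q : F) := fun v =>
    ⟨(padEntry n n₀ l (posIdx (n + n₀) v) : ℚ), by rw [padT_hmrTensorOfList, Rat.cast_intCast]⟩
  obtain ⟨p, hp⟩ := hnat (n + n₀) (Nat.le_add_left _ _) k _ hrat hT'
  obtain ⟨Bk, hBlen, hBidx, hchart, heval⟩ := exists_block_of_isMinrankProof F l hp
  exact ⟨Bk, hBlen, hBidx, hchart, heval⟩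

/-- **COMPLETENESS of the verifier** under the natural-proof hypothesis: an instance outside
`HMinRank1` has a short accepted witness. [cite: BlaserIkenmeyerLysikovPandeySchreyer2019, Cor. 42 (proof) and Thm. 40 (proof)] -/
theorem exists_mem_verifier (hagree : ∀ (m : ℕ) (C : ArithCircuit ℤ (Fin m)),
      m ≤ (circuitWord m C).length → (circuitWord m C ∈ B ↔ C.eval = 0))
    {c₀ n₀ : ℕ}
    (hnat : ∀ n : ℕ, n₀ ≤ n → ∀ (m : ℕ) (T : Fin m → Fin n → Fin n → F),
      (∀ v, ∃ q : ℚ, trilinearPt T v = (q : F)) →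
        T ∉ (minrankSet F 1 : Set (Fin m → Fin n → Fin n → F)) → ∃ p, IsMinrankProof F T 1 (n ^ c₀ + c₀) p)
    {w : List Bool} (hw : w ∉ hmr1Language F) :
    ∃ y : List Bool, y.length ≤ (witnessPoly c₀ n₀).eval w.length ∧ boolPair w y ∈ verifier n₀ B := by
  have heasy : easyFn (boolPair w []) = [true] → ∃ y : List Bool,
      y.length ≤ (witnessPoly c₀ n₀).eval w.length ∧ boolPair w y ∈ verifier n₀ B :=
    fun h => ⟨[], by simp, Or.inl h⟩
  by_cases hcanon : instE (decT w) = w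
  swap
  · exact heasy (by rw [easyFn_apply]; simp [hcanon])
  cases hez : easy (decT w)
  swap
  · exact heasy (by rw [easyFn_apply, hez]; simp)
  have hx : decT w ∉ hmr1Set F := fun hx => hw (by rw [← hcanon]; exact instE_mem_of_mem F hx)
  obtain ⟨hg, Bk, hBlen, hBidx, hchart, heval⟩ := exists_block_of_not_mem F hnat hx hez
  obtain ⟨hwf, -, hn1, hk1⟩ := (guard_eq_true_iff _).1 hg
  refine ⟨encBlock Bk, ?_, Or.inr ⟨?_, ?_⟩⟩
  · -- the witness is short
    refine (length_encBlock_le hBidx).trans ?_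
    rw [eval_witnessPoly]
    have hlen := length_entries_le (decT w)
    rw [hcanon, hwf] at hlen
    have hnL : (decT w).1 ≤ w.length := le_trans (le_trans (by rw [pow_two]; exact Nat.le_mul_of_pos_left _ hn1)
      (Nat.le_mul_of_pos_left _ hk1)) hlen
    have hkL : (decT w).2.1 ≤ w.length := le_trans (Nat.le_mul_of_pos_right _ (pow_pos hn1 2)) hlen
    have h1 : Bk.length ≤ (w.length + n₀) ^ c₀ + c₀ + 1 :=
      hBlen.trans (by have := Nat.pow_le_pow_left (Nat.add_le_add_right hnL n₀) c₀; omega)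
    have h2 : nIn (decT w).2.1 ((decT w).1 + n₀) ≤ w.length * (w.length + n₀) ^ 2 :=
      Nat.mul_le_mul hkL (Nat.pow_le_pow_left (Nat.add_le_add_right hnL n₀) 2)
    exact Nat.mul_le_mul h1 (by omega)
  · show mainFn (boolPair w (encBlock Bk)) = [true]
    rw [mainFn_apply, hcanon, hg]
    simp
  · refine (mem_twoQuery_iff n₀ B _).2 ?_
    rw [chartFn_apply, evalFn_apply,
      wordE_chartInst (s := (decT w, encBlock Bk)) hg, wordE_evalInst (s := (decT w, encBlock Bk)) hg,
      hagree _ _ (nVar_le_length_circuitWord _ _ _), hagree _ _ (Nat.zero_le _)]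
    simp only [readBlock_encBlock]
    exact ⟨hchart, heval⟩

/-- **The complement of `HMinRank1` is in `∃·BPP`** under the natural-proof hypothesis and a `BPP`
identity test for circuit words. [cite: BlaserIkenmeyerLysikovPandeySchreyer2019, Thm. 40 (proof)] -/
theorem compl_hmr1Language_mem_polyExists_BPP (hB : B ∈ BPP)
    (hagree : ∀ (m : ℕ) (C : ArithCircuit ℤ (Fin m)), m ≤ (circuitWord m C).length → (circuitWord m C ∈ B ↔ C.eval = 0))
    {c₀ n₀ : ℕ}
    (hnat : ∀ n : ℕ, n₀ ≤ n → ∀ (m : ℕ) (T : Fin m → Fin n → Fin n → F),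
      (∀ v, ∃ q : ℚ, trilinearPt T v = (q : F)) →
        T ∉ (minrankSet F 1 : Set (Fin m → Fin n → Fin n → F)) → ∃ p, IsMinrankProof F T 1 (n ^ c₀ + c₀) p) :
    (hmr1Language F)ᶜ ∈ polyExists BPP := by
  refine ⟨verifier n₀ B, verifier_mem_BPP n₀ B hB, witnessPoly c₀ n₀, fun w => ⟨fun hw => ?_, fun ⟨y, _, hy⟩ => ?_⟩⟩
  · exact exists_mem_verifier F hagree hnat hw
  · exact not_mem_of_mem_verifier F hagree hy

end Correctness

/-! ### §7. The edge: Cor 42 from a randomised identity test -/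

section Edge

variable (F : Type u) [Field F] [CharZero F]

/-- **BILPS Cor 42 from a `BPP` identity test for integer circuit words**: if some `B ∈ BPP` agrees
with `PITLanguage` on every circuit word `circuitWord m C` with `m ≤ |circuitWord m C|`, then "for
infinitely many `n` there are tensors without `poly(n)`-natural proofs of high minrank, unless
`coNP ⊆ ∃BPP`" (as typed). Proof as printed (Thm 40 applied to `𝓜_1`): were there natural proofs
beyond some size, the verifier above puts `HMinRank1ᶜ` in `∃·BPP`; `HMinRank1` is NP-hard (Cor 35),
so `coNP ⊆ ∃·BPP`. [cite: BlaserIkenmeyerLysikovPandeySchreyer2019, Cor. 42 and Thm. 40 (proof)] -/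
theorem BILPS2019_cor42_of_randomizedPIT {B : Language Bool} (hB : B ∈ BPP)
    (hagree : ∀ (m : ℕ) (C : ArithCircuit ℤ (Fin m)), m ≤ (circuitWord m C).length → (circuitWord m C ∈ B ↔ C.eval = 0)) :
    BILPS2019_cor42 F := by
  intro hco c₀ n₀
  by_contra h
  push Not at h
  refine hco (coNP_subset_polyExists_BPP_of_isNPHard_of_compl_mem (BILPS2019_cor35_holds F)
    (compl_hmr1Language_mem_polyExists_BPP F hB hagree (c₀ := c₀) (n₀ := n₀) fun n hn m T hrat hT => ?_))
  exact h n hn m T 1 hrat hT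

/-- **BILPS Cor 42 from `PIT ∈ BPP`** (the tree's `PITLanguage`: ACIT for division-free integer
circuits, Kabanets–Impagliazzo; classically in `coRP ⊆ BPP` by Schwartz–Zippel / Ibarra–Moran).
[cite: BlaserIkenmeyerLysikovPandeySchreyer2019, Cor. 42] -/
theorem BILPS2019_cor42_of_PIT_mem_BPP (hPIT : PITLanguage ∈ BPP) : BILPS2019_cor42 F :=
  BILPS2019_cor42_of_randomizedPIT F hPIT fun m C _ => circuitWord_mem_PITLanguage m C

end Edge

end BILPS2019Cor42

end Literature.Barriers.ValiantsHypothesis
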